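import Mathlib.CategoryTheory.Galois.Full
import Mathlib.CategoryTheory.Limits.Types.Coproducts
import Mathlib.GroupTheory.GroupAction.SubMulAction

/-!
# Images and complements in a Galois category (proofs)

Proof-only file (no definitions) with three folklore structural facts about a Galois category `C`
(Mathlib `GaloisCategory`, axioms (G1)–(G6) of [SGA1, Exp. V §4]) that [SemiAnbd] §2 and [GeoAn]
§1 use silently ("one verifies immediately that `B(𝒢)` is a connected anabelioid", [SemiAnbd]
Def. 2.1 p. 23):

* `isIso_of_mono_of_surjective_fiber`: a monomorphism which is surjective on fibres is an
  isomorphism (Galois categories are balanced);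
* `exists_image`: every morphism factors as an epimorphism followed by a monomorphism
  (via the fully faithful functor to finite `Aut F`-sets, Mathlib `functorToAction`);
* `image_unique`: such factorisations are unique up to a (compatible) isomorphism;
* `complement_unique`: the complement `Z` of a subobject `A ↪ Y` ((G3): `Y ≅ A ⨿ Z`) is unique up
  to a compatible isomorphism, and only depends on the subobject up to isomorphism.

They are the tools for gluing images and complements along the pull-back functors `b^*` of a
semi-graph of anabelioids (`SemiGraphs/GraphOfAnabelioidsGalois.lean`).
-/

namespace Literature.AnabelianGeometry.Anabelioids

open CategoryTheory CategoryTheory.Limits CategoryTheory.PreGaloisCategory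

universe w v₁ u₁

variable {C : Type u₁} [Category.{v₁} C] [GaloisCategory C]

/-- In a Galois category a monomorphism that is surjective on fibres is an isomorphism.
[cite: SGA1, Exp. V §4 (condition (G6))] -/
theorem isIso_of_mono_of_surjective_fiber (F : C ⥤ FintypeCat.{w}) [FiberFunctor F] {X Y : C}
    (f : X ⟶ Y) [Mono f] (hf : Function.Surjective (F.map f)) : IsIso f :=
  isIso_of_mono_of_eq_card_fiber F f (Nat.card_eq_of_bijective _
    ⟨ConcreteCategory.injective_of_mono_of_preservesPullback (F.map f), hf⟩)

/-- The fibres of the two legs of a binary coproduct diagram are embedded injectively, disjointly,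
and cover (local copy; see `GaloisFullSubcategory.fiber_binaryCofan`). [folklore] -/
private theorem fiber_binaryCofan'' (F : C ⥤ FintypeCat.{w}) [FiberFunctor F] {A B Y : C}
    (m : A ⟶ Y) (u : B ⟶ Y) (hc : IsColimit (BinaryCofan.mk m u)) :
    Function.Injective (F.map m) ∧ Function.Injective (F.map u) ∧
      IsCompl (Set.range (F.map m)) (Set.range (F.map u)) := by
  exact (Types.binaryCofan_isColimit_iff _).mp
    ⟨mapIsColimitOfPreservesOfIsColimit (F ⋙ FintypeCat.incl) m u hc⟩

/-- **Uniqueness of complements** (G3): if `Y ≅ A ⨿ Z` and `Y ≅ A' ⨿ Z'` are coproduct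
decompositions whose first legs define the same subobject (`m = α ≫ m'` for an isomorphism
`α : A ≅ A'`), then there is an isomorphism `γ : Z ≅ Z'` compatible with the second legs.
[cite: SGA1, Exp. V §4 (condition (G3))] -/
theorem complement_unique {A A' Z Z' Y : C} (m : A ⟶ Y) (u : Z ⟶ Y) (m' : A' ⟶ Y) (u' : Z' ⟶ Y)
    (hc : IsColimit (BinaryCofan.mk m u)) (hc' : IsColimit (BinaryCofan.mk m' u'))
    (α : A ≅ A') (hα : m = α.hom ≫ m') : ∃ γ : Z ≅ Z', u = γ.hom ≫ u' := by
  let F := GaloisCategory.getFiberFunctor C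
  obtain ⟨-, -, h1⟩ := fiber_binaryCofan'' F m u hc
  obtain ⟨-, hu'inj, h2⟩ := fiber_binaryCofan'' F m' u' hc'
  haveI : Mono u' := MonoCoprod.binaryCofan_inr _ hc'
  haveI : Mono u := MonoCoprod.binaryCofan_inr _ hc
  -- the two first legs have the same image, hence so do the two second legs
  have hrange : Set.range (F.map m) = Set.range (F.map m') := by
    ext y
    constructor
    · rintro ⟨a, rfl⟩
      exact ⟨F.map α.hom a, by rw [hα, F.map_comp, FintypeCat.comp_apply]⟩
    · rintro ⟨a', rfl⟩
      refine ⟨F.map α.inv a', ?_⟩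
      rw [hα, F.map_comp, FintypeCat.comp_apply, ← FintypeCat.comp_apply (F.map α.inv),
        ← F.map_comp, α.inv_hom_id, F.map_id, FintypeCat.id_apply]
  have hrangeu : Set.range (F.map u) = Set.range (F.map u') := by
    have e1 := h1.compl_eq
    have e2 := h2.compl_eq
    rw [hrange] at e1
    exact e1.symm.trans e2
  -- the pullback of `u` and `u'` projects isomorphically onto both
  have hp : IsIso (pullback.fst u u') := by
    refine isIso_of_mono_of_surjective_fiber F _ fun z => ?_
    obtain ⟨z', hz'⟩ : F.map u z ∈ Set.range (F.map u') := hrangeu ▸ ⟨z, rfl⟩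
    exact ⟨(fiberPullbackEquiv F u u').symm ⟨(z, z'), hz'.symm⟩,
      fiberPullbackEquiv_symm_fst_apply F _ _ _⟩
  have hp' : IsIso (pullback.snd u u') := by
    refine isIso_of_mono_of_surjective_fiber F _ fun z' => ?_
    obtain ⟨z, hz⟩ : F.map u' z' ∈ Set.range (F.map u) := hrangeu.symm ▸ ⟨z', rfl⟩
    exact ⟨(fiberPullbackEquiv F u u').symm ⟨(z, z'), hz⟩,
      fiberPullbackEquiv_symm_snd_apply F _ _ _⟩
  refine ⟨(asIso (pullback.fst u u')).symm ≪≫ asIso (pullback.snd u u'), ?_⟩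
  rw [Iso.trans_hom, Iso.symm_hom, asIso_inv, asIso_hom, Category.assoc, ← pullback.condition,
    IsIso.inv_hom_id_assoc]

/-- **Image factorisation** in a Galois category: every morphism is an epimorphism followed by a
monomorphism (the image is the subobject of the target whose fibre is the image of the map on
fibres, lifted from finite `Aut F`-sets along Mathlib's fully faithful `functorToAction`).
[cite: SGA1, Exp. V §4] -/
theorem exists_image (F : C ⥤ FintypeCat.{u₁}) [FiberFunctor F] {A B : C} (f : A ⟶ B) :
    ∃ (I : C) (e : A ⟶ I) (m : I ⟶ B), Epi e ∧ Mono m ∧ e ≫ m = f := by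
  let H := functorToAction F
  -- the image of `F f` as a sub-`Aut F`-set of `F B`
  let S : SubMulAction (Aut F) (F.obj B) :=
    { carrier := Set.range (F.map f)
      smul_mem' := by
        rintro σ _ ⟨a, rfl⟩
        exact ⟨σ • a, (NatTrans.naturality_apply σ.hom f a).symm⟩ }
  let SA : Action FintypeCat.{u₁} (Aut F) := Action.FintypeCat.ofMulAction (Aut F) (FintypeCat.of S)
  let i : SA ⟶ H.obj B :=
    { hom := FintypeCat.homMk Subtype.val
      comm := fun σ => by
        ext x
        rfl }
  haveI : Mono i := by
    apply Functor.mono_of_mono_map (Action.forget _ _)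
    apply ConcreteCategory.mono_of_injective
    exact Subtype.val_injective
  obtain ⟨I, m, u, hm, hum⟩ := exists_lift_of_mono F B SA i
  -- the corestriction `A → S`, as a map of `Aut F`-sets, lifted along the fully faithful `H`
  let c : H.obj A ⟶ SA :=
    { hom := FintypeCat.homMk fun a => (⟨F.map f a, a, rfl⟩ : S)
      comm := fun σ => by
        ext a
        exact Subtype.ext (NatTrans.naturality_apply σ.hom f a).symm }
  let e : A ⟶ I := H.preimage (c ≫ u.hom)
  have he : H.map e = c ≫ u.hom := H.map_preimage _
  refine ⟨I, e, m, ?_, hm, ?_⟩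
  · -- `e` is surjective on fibres: `c` is surjective and `u` is an isomorphism
    have hsurj : Function.Surjective (F.map e) := by
      intro x
      obtain ⟨⟨_, a, rfl⟩, hs⟩ := (ConcreteCategory.bijective_of_isIso
        ((Action.forget _ _).map u.hom)).2 x
      refine ⟨a, ?_⟩
      have : F.map e = (H.map e).hom := rfl
      rw [this, he]
      exact hs
    haveI : Epi (F.map e) := ConcreteCategory.epi_of_surjective _ hsurj
    exact F.epi_of_epi_map inferInstance
  · apply H.map_injective
    rw [H.map_comp, he, Category.assoc, hum]
    ext a
    rfl

/-- **Uniqueness of images**: two epi-mono factorisations of the same morphism in a Galois category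
differ by a unique compatible isomorphism (existence part). [cite: SGA1, Exp. V §4] -/
theorem image_unique {A I I' B : C} (e : A ⟶ I) (m : I ⟶ B) (e' : A ⟶ I') (m' : I' ⟶ B)
    [Epi e] [Mono m] [Epi e'] [Mono m'] (h : e ≫ m = e' ≫ m') :
    ∃ γ : I ≅ I', e ≫ γ.hom = e' ∧ γ.hom ≫ m' = m := by
  let F := GaloisCategory.getFiberFunctor C
  let k : A ⟶ pullback m m' := pullback.lift e e' h
  have hk : k ≫ pullback.fst m m' = e := pullback.lift_fst _ _ _
  have hk' : k ≫ pullback.snd m m' = e' := pullback.lift_snd _ _ _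
  have hp : IsIso (pullback.fst m m') := by
    refine isIso_of_mono_of_surjective_fiber F _ fun x => ?_
    obtain ⟨a, rfl⟩ := surjective_on_fiber_of_epi F e x
    exact ⟨F.map k a, by rw [← FintypeCat.comp_apply, ← F.map_comp, hk]⟩
  have hp' : IsIso (pullback.snd m m') := by
    refine isIso_of_mono_of_surjective_fiber F _ fun x => ?_
    obtain ⟨a, rfl⟩ := surjective_on_fiber_of_epi F e' x
    exact ⟨F.map k a, by rw [← FintypeCat.comp_apply, ← F.map_comp, hk']⟩
  refine ⟨(asIso (pullback.fst m m')).symm ≪≫ asIso (pullback.snd m m'), ?_, ?_⟩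
  · rw [Iso.trans_hom, Iso.symm_hom, asIso_inv, asIso_hom, ← hk, Category.assoc,
      IsIso.hom_inv_id_assoc, hk']
  · rw [Iso.trans_hom, Iso.symm_hom, asIso_inv, asIso_hom, Category.assoc, ← pullback.condition,
      IsIso.inv_hom_id_assoc]

end Literature.AnabelianGeometry.Anabelioids
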